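import Summits.BirchSwinnertonDyer.BirchSwinnertonDyer.Theorems.CyclotomicUntwistGNineSpecialFibrePointCount
import Summits.BirchSwinnertonDyer.BirchSwinnertonDyer.Theorems.TameQuarticSolventSolventPairLowerBoundSupersingular
import Literature.NumberTheory.EllipticCurves.MinimalModelReduction
import Literature.NumberTheory.EllipticCurves.HasseWeilGoodReduction
import Literature.NumberTheory.EllipticCurves.HasseWeilGoodReductionFrobenius
import Literature.NumberTheory.DiophantineGeometry.LocalReductionFiniteBadPlacesProofs
import Literature.RingTheory.DiscreteValuationRing.AdicCompletionResidueField
import Mathlib.Data.ZMod.Basic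
import HarnessLib

/-!
# A `v`-integral model reducing to `y² = x³ − x + b̄` over a residue field `𝔽₃`: point count and
# Frobenius trace `a_v = −3·b̄` (route `CyclotomicUntwist`, LAW L-a3 at the W-level, bridge lemma)

Cell `pub/bsd-wall` (D-0145 line `route-BirchSwinnertonDyer-CyclotomicUntwist`), seat `bsd-line-cycu-p3`
(gen 7). Helper toward K1 `PSRankOneLowerHalfAtThree` (stmt-BirchSwinnertonDyer-21580) / K2 (21581).
THEOREMS ONLY (no definition, no named fact, no `sorry`); BSD is not proved by this file and no crux is.

This is the model-to-place BRIDGE of the W-level form of LAW L-a3 (N) («`a_w(W)` is the trace of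
Frobenius of `W ⊗ ℚ(ζ₉)` at the place `w ∣ 3`», memo `Cruxes/PSRankOneLowerHalfAtThree/LAW-La3-KERNEL-v4.md`
§3 «NOT KERNEL»). Over ANY number field `K` and finite place `v` with residue field of order `3`:
a Weierstrass equation `X/K` whose coefficients satisfy
`v(a₁), v(a₂), v(a₃) < 1`, `v(a₄ + 1) < 1`, `v(a₆ − b) < 1` (`b ∈ ℤ`) and `v(Δ) = 1` (multiplicative
valuations; i.e. `X` is `v`-integral, reduces to `y² = x³ − x + b̄`, and has unit discriminant) has

* `natCard_point_reductionAt_of_specialFibre` — `#X̃_v(k_v) = #{y² = x³ − x + b̄}(𝔽₃)` (the chosen local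
  minimal model `reductionAt` has as many points as the given minimal equation, Silverman VII.1.3(b),
  tree `natCard_point_reduction_minimal`; the reduction of the given equation is `⟨0,0,0,−1,b̄⟩` read in
  `k_v ≃ ZMod 3`, tree `natCard_point_map_ringEquiv`);
* `natCard_point_reductionAt_eq_of_specialFibre` — `= 4 + 3·valMinAbs b̄ ∈ {1, 4, 7}` (my lineage's
  point count `GNineSpecialFibrePointCount.natCard_point_specialFibre`, p617081);
* `frobeniusTraceAt_eq_of_specialFibre` — **`a_v(X) = −3·valMinAbs b̄`** (`a_v = #k_v + 1 − #X̃_v(k_v)`,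
  tree `frobeniusTraceAt`), `three_dvd_frobeniusTraceAt_of_specialFibre` (supersingular: `3 ∣ a_v`),
  `hasGoodReductionAt_of_specialFibre`.

Template: `SolventPairLowerBound.natCard_point_reductionAt_of_valuation_lt_one` (route `TameQuarticSolvent`,
the `y² = x³ + ā₄x` case), whose residue lemma `residue_eq_zero_of_valuation_lt_one` is reused by name.

References: J. H. Silverman, *AEC* VII.1 (Rem. 1.1, Prop. 1.3(b)), VII.5.1(a), V.2, C.§16 [SilvermanAEC2009];
J. Tate, LNM 476 (1975) §7 [Tate1975].
-/

-- single-conjunct summit: `Summit.BirchSwinnertonDyer.BirchSwinnertonDyer.…` repeats the name by design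
set_option linter.dupNamespace false
set_option autoImplicit false

noncomputable section

open scoped NumberField Classical

open IsDedekindDomain IsDedekindDomain.HeightOneSpectrum NumberField WeierstrassCurve
  Literature.NumberTheory.EllipticCurves

namespace Summit.BirchSwinnertonDyer.BirchSwinnertonDyer.Theorems.GNineFrobeniusTrace

variable {K : Type} [Field K] [NumberField K] (X : WeierstrassCurve K) (v : HeightOneSpectrum (𝓞 K))

/-! ### Valuation bookkeeping -/

/-- An integer has `v`-valuation `≤ 1`. [folklore] -/
theorem valuation_intCast_le_one (b : ℤ) : v.valuation K (b : K) ≤ 1 := by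
  have h := HeightOneSpectrum.valuation_le_one (K := K) v ((b : ℤ) : 𝓞 K)
  simpa using h

/-- `v(a₄ + 1) < 1 ⟹ v(a₄) ≤ 1`. [folklore] -/
theorem valuation_le_one_of_valuation_add_one_lt_one {x : K} (h : v.valuation K (x + 1) < 1) :
    v.valuation K x ≤ 1 := by
  have hx : x = (x + 1) - 1 := by ring
  rw [hx]
  refine (Valuation.map_sub _ _ _).trans (max_le h.le ?_)
  rw [map_one]

/-- `v(a₆ − b) < 1`, `b ∈ ℤ` ⟹ `v(a₆) ≤ 1`. [folklore] -/
theorem valuation_le_one_of_valuation_sub_intCast_lt_one {x : K} {b : ℤ}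
    (h : v.valuation K (x - b) < 1) : v.valuation K x ≤ 1 := by
  have hx : x = (x - b) + b := by ring
  rw [hx]
  exact (Valuation.map_add _ _ _).trans (max_le h.le (valuation_intCast_le_one v b))

/-! ### The residue field of order `3` -/

/-- A residue field with three elements is `ZMod 3` (as a ring). [folklore] -/
theorem nonempty_ringEquiv_zmod_three (hq : Nat.card (𝓞 K ⧸ v.asIdeal) = 3) :
    Nonempty (ZMod 3 ≃+* IsLocalRing.ResidueField (v.adicCompletionIntegers K)) := by
  letI : Fintype (IsLocalRing.ResidueField (v.adicCompletionIntegers K)) := Fintype.ofFinite _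
  have hcard : Fintype.card (IsLocalRing.ResidueField (v.adicCompletionIntegers K)) = 3 := by
    rw [Fintype.card_eq_nat_card,
      IsDedekindDomain.HeightOneSpectrum.natCard_residueField_adicCompletionIntegers K v, hq]
  exact ⟨ZMod.ringEquivOfPrime _ Nat.prime_three hcard⟩

/-! ### The reduction of the given equation -/

/-- **The given equation reduces to `y² = x³ − x + b̄`.** Under the hypotheses of the file the `𝒪_v`-integral
model of `X ⊗ K_v` reduces, coefficientwise, to `⟨0, 0, 0, −1, b̄⟩` over the residue field `k_v`.
[cite: SilvermanAEC2009, VII.1 Rem. 1.1 and VII.2] -/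
theorem reduction_eq_of_specialFibre (b : ℤ)
    (h₁ : v.valuation K X.a₁ < 1) (h₂ : v.valuation K X.a₂ < 1) (h₃ : v.valuation K X.a₃ < 1)
    (h₄ : v.valuation K (X.a₄ + 1) < 1) (h₆ : v.valuation K (X.a₆ - b) < 1)
    [hint : (X.baseChange (v.adicCompletion K)).IsIntegral (v.adicCompletionIntegers K)]
    [hmin : (X.baseChange (v.adicCompletion K)).IsMinimal (v.adicCompletionIntegers K)] :
    (X.baseChange (v.adicCompletion K)).reduction (v.adicCompletionIntegers K) =
      ⟨0, 0, 0, -1, (b : IsLocalRing.ResidueField (v.adicCompletionIntegers K))⟩ := by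
  set R := v.adicCompletionIntegers K with hR
  set Xv : WeierstrassCurve (v.adicCompletion K) := X.baseChange (v.adicCompletion K) with hXv
  have hcoef : ∀ {x : K} {r : R}, algebraMap R (v.adicCompletion K) r = algebraMap K _ x →
      v.valuation K x < 1 → IsLocalRing.residue R r = 0 := fun {x r} hr hx ↦
    SolventPairLowerBound.residue_eq_zero_of_valuation_lt_one v hr hx
  have ha₁ : IsLocalRing.residue R (integralModel R Xv).a₁ = 0 :=
    hcoef (by rw [integralModel_a₁_eq]; rfl) h₁
  have ha₂ : IsLocalRing.residue R (integralModel R Xv).a₂ = 0 :=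
    hcoef (by rw [integralModel_a₂_eq]; rfl) h₂
  have ha₃ : IsLocalRing.residue R (integralModel R Xv).a₃ = 0 :=
    hcoef (by rw [integralModel_a₃_eq]; rfl) h₃
  have ha₄ : IsLocalRing.residue R (integralModel R Xv).a₄ = -1 := by
    have h0 : IsLocalRing.residue R ((integralModel R Xv).a₄ + 1) = 0 := by
      refine hcoef (x := X.a₄ + 1) ?_ h₄
      rw [map_add, map_one, integralModel_a₄_eq, hXv, WeierstrassCurve.baseChange, map_a₄]
      simp
    rw [map_add, map_one] at h0
    exact eq_neg_of_add_eq_zero_left h0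
  have ha₆ : IsLocalRing.residue R (integralModel R Xv).a₆ = (b : IsLocalRing.ResidueField R) := by
    have h0 : IsLocalRing.residue R ((integralModel R Xv).a₆ - (b : R)) = 0 := by
      refine hcoef (x := X.a₆ - b) ?_ h₆
      rw [map_sub, map_intCast, integralModel_a₆_eq, hXv, WeierstrassCurve.baseChange, map_a₆]
      simp
    rw [map_sub, map_intCast] at h0
    exact sub_eq_zero.mp h0
  rw [WeierstrassCurve.reduction]
  ext
  · rw [map_a₁]; exact ha₁
  · rw [map_a₂]; exact ha₂
  · rw [map_a₃]; exact ha₃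
  · rw [map_a₄]; exact ha₄
  · rw [map_a₆]; exact ha₆

/-! ### Point count and Frobenius trace -/

/-- **`#X̃_v(k_v) = #{y² = x³ − x + b̄}(𝔽₃)`** for a `v`-integral model with `v(a₁), v(a₂), v(a₃) < 1`,
`v(a₄ + 1) < 1`, `v(a₆ − b) < 1`, unit discriminant and `#k_v = 3`: the chosen local minimal model has as many
points as the given (minimal) equation (Silverman VII.1.3(b)), whose reduction is `⟨0, 0, 0, −1, b̄⟩`, read in
`𝔽₃` along `k_v ≃ ZMod 3`. [cite: SilvermanAEC2009, VII.1 Prop. 1.3(b) and VII.5 Prop. 5.1(a)] -/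
theorem natCard_point_reductionAt_of_specialFibre (b : ℤ)
    (h₁ : v.valuation K X.a₁ < 1) (h₂ : v.valuation K X.a₂ < 1) (h₃ : v.valuation K X.a₃ < 1)
    (h₄ : v.valuation K (X.a₄ + 1) < 1) (h₆ : v.valuation K (X.a₆ - b) < 1)
    (hΔ : v.valuation K X.Δ = 1) (hq : Nat.card (𝓞 K ⧸ v.asIdeal) = 3) :
    Nat.card (X.reductionAt v).toAffine.Point =
      Nat.card (⟨0, 0, 0, -1, (b : ZMod 3)⟩ : WeierstrassCurve (ZMod 3)).toAffine.Point := by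
  set R := v.adicCompletionIntegers K with hR
  set Xv : WeierstrassCurve (v.adicCompletion K) := X.baseChange (v.adicCompletion K) with hXv
  have h₄' : v.valuation K X.a₄ ≤ 1 := valuation_le_one_of_valuation_add_one_lt_one v h₄
  have h₆' : v.valuation K X.a₆ ≤ 1 := valuation_le_one_of_valuation_sub_intCast_lt_one v h₆
  have hint : X.IsIntegralAt v := X.isIntegralAt_of_valuation_le_one v h₁.le h₂.le h₃.le h₄' h₆'
  haveI hintI : Xv.IsIntegral R := hint
  have hgood : Xv.HasGoodReduction R := X.hasGoodReduction_baseChange_of_valuation_Δ_eq_one v hint hΔ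
  haveI : Xv.IsMinimal R := hgood.toIsMinimal
  have hΔX : X.Δ ≠ 0 := by
    intro h; rw [h, map_zero] at hΔ; exact zero_ne_one hΔ
  have hΔ0 : Xv.Δ ≠ 0 := by
    rw [hXv, WeierstrassCurve.baseChange, WeierstrassCurve.map_Δ]
    exact (map_ne_zero_iff _ (algebraMap K (v.adicCompletion K)).injective).mpr hΔX
  -- the chosen minimal model and the given minimal equation have equally many points
  have h1 : Nat.card (X.reductionAt v).toAffine.Point = Nat.card (Xv.reduction R).toAffine.Point :=
    natCard_point_reduction_minimal Xv hΔ0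
  rw [h1, reduction_eq_of_specialFibre X v b h₁ h₂ h₃ h₄ h₆]
  -- read the reduction in `ZMod 3`
  obtain ⟨e⟩ := nonempty_ringEquiv_zmod_three v hq
  have hmap : (⟨0, 0, 0, -1, (b : IsLocalRing.ResidueField R)⟩ : WeierstrassCurve (IsLocalRing.ResidueField R)) =
      (⟨0, 0, 0, -1, (b : ZMod 3)⟩ : WeierstrassCurve (ZMod 3)).map (e : ZMod 3 →+* IsLocalRing.ResidueField R) := by
    ext <;> simp
  rw [hmap, natCard_point_map_ringEquiv]

/-- **`#X̃_v(k_v) = 4 + 3·valMinAbs b̄`** (`= 4, 7, 1` for `b̄ = 0, 1, −1`). [cite: SilvermanAEC2009, V.2]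
[cite: Tate1975, §7] -/
theorem natCard_point_reductionAt_eq_of_specialFibre (b : ℤ)
    (h₁ : v.valuation K X.a₁ < 1) (h₂ : v.valuation K X.a₂ < 1) (h₃ : v.valuation K X.a₃ < 1)
    (h₄ : v.valuation K (X.a₄ + 1) < 1) (h₆ : v.valuation K (X.a₆ - b) < 1)
    (hΔ : v.valuation K X.Δ = 1) (hq : Nat.card (𝓞 K ⧸ v.asIdeal) = 3) :
    (Nat.card (X.reductionAt v).toAffine.Point : ℤ) = 4 + 3 * ZMod.valMinAbs (b : ZMod 3) := by
  rw [natCard_point_reductionAt_of_specialFibre X v b h₁ h₂ h₃ h₄ h₆ hΔ hq]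
  exact GNineSpecialFibrePointCount.natCard_point_specialFibre _

/-- **`a_v(X) = −3·valMinAbs b̄`**: the trace of Frobenius at `v` of a `v`-integral model reducing to
`y² = x³ − x + b̄` over `k_v = 𝔽₃` (`a_v = #k_v + 1 − #X̃_v(k_v)`, Silverman C.§16; `#X̃_v = 4 + 3·valMinAbs b̄`).
[cite: SilvermanAEC2009, C.§16 and V.2] [cite: Tate1975, §7] -/
theorem frobeniusTraceAt_eq_of_specialFibre (b : ℤ)
    (h₁ : v.valuation K X.a₁ < 1) (h₂ : v.valuation K X.a₂ < 1) (h₃ : v.valuation K X.a₃ < 1)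
    (h₄ : v.valuation K (X.a₄ + 1) < 1) (h₆ : v.valuation K (X.a₆ - b) < 1)
    (hΔ : v.valuation K X.Δ = 1) (hq : Nat.card (𝓞 K ⧸ v.asIdeal) = 3) :
    X.frobeniusTraceAt v = -3 * ZMod.valMinAbs (b : ZMod 3) := by
  rw [frobeniusTraceAt_def, IsDedekindDomain.HeightOneSpectrum.natCard_residueField_adicCompletionIntegers K v,
    hq, natCard_point_reductionAt_eq_of_specialFibre X v b h₁ h₂ h₃ h₄ h₆ hΔ hq]
  push_cast
  ring

/-- **Supersingular**: `3 ∣ a_v(X)`. [cite: SilvermanAEC2009, V.4 (Ex. 4.4: j = 0 in characteristic 3)] -/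
theorem three_dvd_frobeniusTraceAt_of_specialFibre (b : ℤ)
    (h₁ : v.valuation K X.a₁ < 1) (h₂ : v.valuation K X.a₂ < 1) (h₃ : v.valuation K X.a₃ < 1)
    (h₄ : v.valuation K (X.a₄ + 1) < 1) (h₆ : v.valuation K (X.a₆ - b) < 1)
    (hΔ : v.valuation K X.Δ = 1) (hq : Nat.card (𝓞 K ⧸ v.asIdeal) = 3) :
    (3 : ℤ) ∣ X.frobeniusTraceAt v := by
  rw [frobeniusTraceAt_eq_of_specialFibre X v b h₁ h₂ h₃ h₄ h₆ hΔ hq]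
  exact ⟨-ZMod.valMinAbs (b : ZMod 3), by ring⟩

/-- The values: `a_v(X) ∈ {0, 3, −3}`. [cite: SilvermanAEC2009, V.2] -/
theorem frobeniusTraceAt_mem_of_specialFibre (b : ℤ)
    (h₁ : v.valuation K X.a₁ < 1) (h₂ : v.valuation K X.a₂ < 1) (h₃ : v.valuation K X.a₃ < 1)
    (h₄ : v.valuation K (X.a₄ + 1) < 1) (h₆ : v.valuation K (X.a₆ - b) < 1)
    (hΔ : v.valuation K X.Δ = 1) (hq : Nat.card (𝓞 K ⧸ v.asIdeal) = 3) :
    X.frobeniusTraceAt v = 0 ∨ X.frobeniusTraceAt v = 3 ∨ X.frobeniusTraceAt v = -3 := by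
  rw [frobeniusTraceAt_eq_of_specialFibre X v b h₁ h₂ h₃ h₄ h₆ hΔ hq]
  rcases GNineSpecialFibrePointCount.zmod_three_cases (b : ZMod 3) with h | h | h <;> rw [h] <;> decide

/-- Good reduction at `v` (the given equation is `v`-integral with unit discriminant).
[cite: SilvermanAEC2009, VII.5 Prop. 5.1(a)] -/
theorem hasGoodReductionAt_of_specialFibre (b : ℤ)
    (h₁ : v.valuation K X.a₁ < 1) (h₂ : v.valuation K X.a₂ < 1) (h₃ : v.valuation K X.a₃ < 1)
    (h₄ : v.valuation K (X.a₄ + 1) < 1) (h₆ : v.valuation K (X.a₆ - b) < 1)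
    (hΔ : v.valuation K X.Δ = 1) : X.HasGoodReductionAt v :=
  X.hasGoodReductionAt_of_valuation_le_one_of_valuation_Δ_eq_one v h₁.le h₂.le h₃.le
    (valuation_le_one_of_valuation_add_one_lt_one v h₄)
    (valuation_le_one_of_valuation_sub_intCast_lt_one v h₆) hΔ

end Summit.BirchSwinnertonDyer.BirchSwinnertonDyer.Theorems.GNineFrobeniusTrace

end
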